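import Summits.BirchSwinnertonDyer.BirchSwinnertonDyer.Theorems.OneSidedTwistSqueezeX9KatoDivisibilityX9KolyvaginReciprocityPkTameNorm
import Summits.BirchSwinnertonDyer.BirchSwinnertonDyer.Theorems.OneSidedTwistSqueezeX9KatoDivisibilityX9KolyvaginReciprocityPkShapiro
import Summits.BirchSwinnertonDyer.BirchSwinnertonDyer.Theorems.SmallImageMuTransferMuTransferX9CoresUnramifiedAt
import Literature.NumberTheory.EllipticCurves.Kato2004.IwasawaH1ReductionTowerPk
import HarnessLib

set_option autoImplicit false

-- the summit and its single problem are both named `BirchSwinnertonDyer` (registry layout D-0017)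
set_option linter.dupNamespace false

/-!
# Crux `KatoDivisibilityX9` (stmt-BirchSwinnertonDyer-20547), line `graded_euler_loss`, stub
# `stub_reciprocityPkAX9` (hG34ᵍ), item (M1) of `hKolyRecPk`, file 3: THE GENUINE TAME CLASS MODULO `p^k` —
# Kato's `cor_{ℚ(μ_q)/ℚ} z_q = P_q(Fr_q⁻¹)·z_1` read in `H¹(Gal(ℚ̄/ℚ(μ_ℓ)), 𝒯_J^{(k)}(E))`,
# `𝒯_J^{(k)}(E) = E[p^k] ⊗ (ℤ/p^k)[T]/(T^J)(χ_κ)`, through the level-`p^k` inverse Shapiro map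

Seat `bsd-line-k6-p4` (prover-bsd-line-k6-p4-g5-0, wave-2 stub worker B).  THEOREMS ONLY (no definition, no named
fact, no `sorry`); nothing asserted about any curve; `--supports stmt-BirchSwinnertonDyer-20547 --as helper`.
Level-`p^k` twin of koly's `TameClass.exists_tameClass_of_isEulerSystemClass` (`…X9TameClass`, p-torsion, level
`p^n`): here the coefficients are `E[p^k] = W.torsionGaloisModule ((p:ℤ)^k)`, the carrier is T6a's
`κ.twistModPk _ (W.pow_nsmul_geomTorsion_eq_zero p k) J` at ANY level `J` admissible for the layer `n`
(`J ≤ p^{n+1−k}`), the class `𝐳̄₁` is the `J`-th component of T6c's `I.redTowerPk k s` (read at layer `n` by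
`redTowerPk_apply_coe_eq_of_level`), the Euler factor is an INTEGER lift `P̄` of Rubin's factor MODULO `p^k`.

* **`exists_tameClassPk_of_isEulerSystemClass`** — for `IsEulerSystemClass W p κ γ I s`: a finite `S₀` (the
  Euler system's bad set, the places of `p` and `2`) such that for `q ∉ S₀` (prime `ℓ`), a layer `n`, a level
  `J ≤ p^{n+1−k}`, an arithmetic Frobenius `Fr` at `q`, `P̄ ≡ P(Fr⁻¹ | T_pW*; X) (mod p^k)`, `a ≡ κ̄_n(Fr) (mod p^n)`:
  a class `y ∈ H¹(Gal(ℚ̄/ℚ(μ_ℓ)), 𝒯_J^{(k)}(E))` which is (i) INTEGRAL and (ii) has `cor_N^{Γ_ℚ} y = [ψ]`,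
  `ψ(g) = P̄((1+S)^a)(φ(g))`, for every cocycle `φ` of `(I.redTowerPk k s)_J`.
  Ingredients: file 1 (the tame norm relation reduced mod `p^k`), file 2 (the level-`p^k` Shapiro dictionary and
  the relative inverse Shapiro map), koly's generic `coresLe_cons_mem_integralH1` / `coresLe_mem_integralH1_inf`
  (Kato (8.1.3)) and x9's `subgroupIsUnramifiedAt_layerSubgroup`.

References: K. Kato, Astérisque 295 (2004) (8.1.3), §13.1 (13.1.1), Ex. 13.3, §13.8 [Kato2004Asterisque]; K. Rubin,
*Euler Systems* (2000) Def. 2.1.1, Lemma 4.4.2; J.-P. Serre, *Galois Cohomology* I §2.5 [SerreGaloisCohomology1997];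
B. Mazur, K. Rubin, Mem. AMS 799 (2004) §5.3 [MazurRubin2004].
-/

noncomputable section

open CategoryTheory Function Finset Polynomial
open scoped NumberField Pointwise ContRepresentation
open Field IsDedekindDomain
open Literature.NumberTheory.GaloisRepresentations
open Literature.NumberTheory.EllipticCurves
open Literature.NumberTheory.EllipticCurves.ZpExtension
open Literature.NumberTheory.EllipticCurves.Kato2004
open Literature.NumberTheory.EllipticCurves.Kato2004.EulerSystemValues
open Rat.HeightOneSpectrum
open WeierstrassCurve (geomPoints geomTorsion galoisRepTorsion)
open Summit.BirchSwinnertonDyer.Rank1Residual.GaloisImage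
open Summit.BirchSwinnertonDyer.BirchSwinnertonDyer.Rank1Residual
open Summit.BirchSwinnertonDyer.BirchSwinnertonDyer.Theorems.OneSidedTwistSqueezeX9KatoDivisibilityX9KolyvaginReciprocityPkTameNorm
open Summit.BirchSwinnertonDyer.BirchSwinnertonDyer.Theorems.OneSidedTwistSqueezeX9KatoDivisibilityX9KolyvaginReciprocityPkShapiro

namespace Summit.BirchSwinnertonDyer.BirchSwinnertonDyer.Theorems.OneSidedTwistSqueezeX9KatoDivisibilityX9KolyvaginReciprocityPkTameClass

variable (W : WeierstrassCurve ℚ) [W.IsElliptic] (p : ℕ) [Fact p.Prime] (k : ℕ)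
  [ContinuousSMul ℤ_[p] (W.tateModule p)]
  [Module.Free ℤ_[p] (W.tateModule p)] [Module.Finite ℤ_[p] (W.tateModule p)]
  (κ : ZpExtension ℚ p) (γ : absoluteGaloisGroup ℚ) (I : IwasawaH1Data W p κ γ)

/-- **THE GENUINE TAME CLASS MODULO `p^k` (item (M1) of `hKolyRecPk`).**  Let `s ∈ 𝐇¹_Γ(T_pW)` be a genuine
Λ-adic Euler-system class.  There is a finite set `S₀` of places such that for every `q ∉ S₀` with prime `ℓ`, every
layer `n` and level `J ≤ p^{n+1−k}`, every arithmetic Frobenius `Fr` at `q`, every `P̄ ∈ ℤ[X]` lifting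
`P(Fr⁻¹ | T_pW*; X) mod p^k` and every `a ≡ κ̄_n(Fr) (mod pⁿ)`, there is
`y ∈ H¹(Gal(ℚ̄/ℚ(μ_ℓ)), 𝒯_J^{(k)}(E))` which is (i) INTEGRAL (`Kato2004.integralH1`) and (ii) satisfies the NORM
RELATION `cor_N^{Γ_ℚ} y = P̄((1+T)^a)·𝐳̄₁` in cocycle form: for every cocycle `φ` of `𝐳̄₁ := (I.redTowerPk k s)_J`
there is a cocycle `ψ` with `ψ(g) = P̄((1+S)^a)(φ(g))` and `cor_N^{Γ_ℚ} y = [ψ]`.  This is Kato's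
`cor_{ℚ(μ_q)/ℚ} 𝐳̄_q = P_q(Fr_q⁻¹)·𝐳̄₁` ((13.1.1), Ex. 13.3) read modulo `(p^k, T^J)` through the level-`p^k`
inverse Shapiro map; `y = cor_{N∩Γ_n}^{N}(H¹(m ↦ m T⁰)(red_{p^k} (cor z_{n+1,{q}})))`.
[cite: Kato2004Asterisque, (8.1.3), §13.1 (13.1.1), Ex. 13.3 (pp. 224–225) and §13.8 (p. 228)]
[cite: SerreGaloisCohomology1997, I §2.5 Prop. 10 and (b)] -/
theorem exists_tameClassPk_of_isEulerSystemClass {s : I.H} (hES : IsEulerSystemClass W p κ γ I s) :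
    ∃ S₀ : Set (HeightOneSpectrum (𝓞 ℚ)), S₀.Finite ∧
      ∀ (q : HeightOneSpectrum (𝓞 ℚ)), q ∉ S₀ →
      ∀ (n J : ℕ) (hJ : J ≤ p ^ (n + 1 - k)) (Fr : absoluteGaloisGroup ℚ), IsArithFrobAtPlace ℚ q Fr →
      ∀ (Pz : ℤ[X]), Pz.map (Int.castRingHom (ZMod (p ^ k))) =
          (rubinEulerFactor (tateRep W p).toRepresentation
            (cyclotomicCharacterToUnits ℚ p ℤ_[p]) Fr).map (PadicInt.toZModPow k) →
      ∀ (a : ℕ), (a : ZMod (p ^ n)) = κ.layerIndex n Fr →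
      ∀ [Fintype (absoluteGaloisGroup ℚ ⧸ rootsOfUnityFixer ℚ ((primesEquiv q : Nat.Primes) : ℕ))]
        (hN : IsOpen ((rootsOfUnityFixer ℚ ((primesEquiv q : Nat.Primes) : ℕ) :
          Subgroup (absoluteGaloisGroup ℚ)) : Set (absoluteGaloisGroup ℚ))),
      ∃ y : H1 (κ.twistModPk (W.torsionGaloisModule ((p : ℤ) ^ k)) (W.pow_nsmul_geomTorsion_eq_zero p k) J)
          (rootsOfUnityFixer ℚ ((primesEquiv q : Nat.Primes) : ℕ)),
        y ∈ integralH1 (κ.twistModPk (W.torsionGaloisModule ((p : ℤ) ^ k))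
          (W.pow_nsmul_geomTorsion_eq_zero p k) J) p
          (rootsOfUnityFixer ℚ ((primesEquiv q : Nat.Primes) : ℕ)) ∧
        ∀ φ : contOneCocycles (κ.twistModPk (W.torsionGaloisModule ((p : ℤ) ^ k))
            (W.pow_nsmul_geomTorsion_eq_zero p k) J).toTopRep,
          oneCocycleClass _ φ = (I.redTowerPk k s : ∀ J : ℕ, galoisCohomology (κ.twistModPk
            (W.torsionGaloisModule ((p : ℤ) ^ k)) (W.pow_nsmul_geomTorsion_eq_zero p k) J) 1) J →
          ∃ ψ : contOneCocycles (κ.twistModPk (W.torsionGaloisModule ((p : ℤ) ^ k))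
              (W.pow_nsmul_geomTorsion_eq_zero p k) J).toTopRep,
            (∀ g, ψ.1 g = aeval (unipotentPow (geomTorsion W ((p : ℤ) ^ k)) J a) Pz (φ.1 g)) ∧
            cores (κ.twistModPk (W.torsionGaloisModule ((p : ℤ) ^ k)) (W.pow_nsmul_geomTorsion_eq_zero p k)
              J).toTopRep (rootsOfUnityFixer ℚ ((primesEquiv q : Nat.Primes) : ℕ)) hN y =
              oneCocycleClass _ ψ := by
  classical
  obtain ⟨S, hSfin, z, hz, hint, h, hproj⟩ := hES
  -- the exceptional set: `S`, and the places of `p` and `2`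
  refine ⟨S ∪ {v | ((primesEquiv v : Nat.Primes) : ℕ) = p ∨ ((primesEquiv v : Nat.Primes) : ℕ) = 2},
    hSfin.union ?_, ?_⟩
  · have hinj : Set.InjOn (fun v : HeightOneSpectrum (𝓞 ℚ) ↦ ((primesEquiv v : Nat.Primes) : ℕ))
        ((fun v : HeightOneSpectrum (𝓞 ℚ) ↦ ((primesEquiv v : Nat.Primes) : ℕ)) ⁻¹' {p, 2}) :=
      fun a _ b _ hab ↦ primesEquiv.injective (Subtype.ext hab)
    exact (Set.toFinite ({p, 2} : Set ℕ)).preimage hinj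
  intro q hq0 n J hJ Fr hFr Pz hPz a ha _ hN
  simp only [Set.mem_union, Set.mem_setOf_eq, not_or] at hq0
  obtain ⟨hqS, hqp, hq2⟩ := hq0
  have hq : q ∈ (cyclotomicLevelsRat p S).primes := ⟨hqS, hqp⟩
  haveI : NeZero ((primesEquiv q : Nat.Primes) : ℕ) := ⟨(primesEquiv q).2.ne_zero⟩
  haveI : NeZero (((primesEquiv q : Nat.Primes) : ℕ) : ℚ) :=
    ⟨Nat.cast_ne_zero.mpr (primesEquiv q).2.ne_zero⟩
  haveI hNn : (rootsOfUnityFixer ℚ ((primesEquiv q : Nat.Primes) : ℕ)).Normal :=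
    Subgroup.Normal.of_commutator_le _ (commutator_le_rootsOfUnityFixer ℚ _)
  -- abbreviations for the coefficient module
  set ρk : DiscreteGaloisModule ℚ (geomTorsion W ((p : ℤ) ^ k)) := W.torsionGaloisModule ((p : ℤ) ^ k)
    with hρk
  -- the subgroups `V = Gal(ℚ̄/ℚ(μ_{p^{n+1}}, μ_ℓ)) ≤ U = N ∩ Γ_n ≤ Γ_n`, `U ≤ N`
  have hUo : IsOpen ((rootsOfUnityFixer ℚ ((primesEquiv q : Nat.Primes) : ℕ) ⊓ κ.layerSubgroup n :
      Subgroup (absoluteGaloisGroup ℚ)) : Set (absoluteGaloisGroup ℚ)) :=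
    TameClass.isOpen_inf_layerSubgroup κ n _ hN
  have hle : (cyclotomicLevelsRat p S).level (n + 1) ((cyclotomicLevelsRat p S).idealOne.cons q hq).1 ≤
      (cyclotomicLevelsRat p S).level (n + 1) ∅ :=
    (cyclotomicLevelsRat p S).level_insert_le (n + 1) (cyclotomicLevelsRat p S).idealOne.1 q
  have hVU : (cyclotomicLevelsRat p S).level (n + 1) ((cyclotomicLevelsRat p S).idealOne.cons q hq).1 ≤
      rootsOfUnityFixer ℚ ((primesEquiv q : Nat.Primes) : ℕ) ⊓ κ.layerSubgroup n := by
    intro g hg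
    refine ⟨?_, h n (hle hg)⟩
    rw [EulerSystemLevels.mem_level_iff] at hg
    exact hg.2 q (Finset.mem_insert_self q _)
  -- finiteness instances (all `Fintype.ofFinite`, matching `coresToLayer` / `coresCons`)
  haveI : (rootsOfUnityFixer ℚ ((primesEquiv q : Nat.Primes) : ℕ) ⊓ κ.layerSubgroup n).FiniteIndex :=
    finiteIndex_of_isOpen_of_compactSpace _ hUo
  letI : Fintype (absoluteGaloisGroup ℚ ⧸ κ.layerSubgroup n) := κ.fintypeQuotientLayer n
  letI : Fintype (absoluteGaloisGroup ℚ ⧸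
      (rootsOfUnityFixer ℚ ((primesEquiv q : Nat.Primes) : ℕ) ⊓ κ.layerSubgroup n)) :=
    Fintype.ofFinite _
  letI : Fintype (↥(rootsOfUnityFixer ℚ ((primesEquiv q : Nat.Primes) : ℕ)) ⧸
      (rootsOfUnityFixer ℚ ((primesEquiv q : Nat.Primes) : ℕ) ⊓ κ.layerSubgroup n).subgroupOf
        (rootsOfUnityFixer ℚ ((primesEquiv q : Nat.Primes) : ℕ))) :=
    Fintype.ofFinite _
  letI : Fintype (↥(κ.layerSubgroup n) ⧸
      (rootsOfUnityFixer ℚ ((primesEquiv q : Nat.Primes) : ℕ) ⊓ κ.layerSubgroup n).subgroupOf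
        (κ.layerSubgroup n)) :=
    Fintype.ofFinite _
  letI : Fintype (↥(κ.layerSubgroup n) ⧸
      ((cyclotomicLevelsRat p S).level (n + 1) ∅).subgroupOf (κ.layerSubgroup n)) :=
    Fintype.ofFinite _
  letI : Fintype (↥(rootsOfUnityFixer ℚ ((primesEquiv q : Nat.Primes) : ℕ) ⊓ κ.layerSubgroup n) ⧸
      ((cyclotomicLevelsRat p S).level (n + 1) ((cyclotomicLevelsRat p S).idealOne.cons q hq).1).subgroupOf
        (rootsOfUnityFixer ℚ ((primesEquiv q : Nat.Primes) : ℕ) ⊓ κ.layerSubgroup n)) :=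
    Fintype.ofFinite _
  -- the tame class at the layer `ℚ_n(μ_ℓ)` with `T_pW`-coefficients: integral, and so is its reduction
  have hyT : coresLe (tateRep W p).toTopRep hVU ((cyclotomicLevelsRat p S).isOpen_level (n + 1) _)
      (z (n + 1) ((cyclotomicLevelsRat p S).idealOne.cons q hq)) ∈
      integralH1 (tateRep W p) p
        (rootsOfUnityFixer ℚ ((primesEquiv q : Nat.Primes) : ℕ) ⊓ κ.layerSubgroup n) :=
    TameClass.coresLe_cons_mem_integralH1 W p hint (n + 1) hq hVU
  have hred := reduceH1Pk_mem_integralH1 W p k _ hyT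
  -- the norm relation at the layer, modulo `p^k`
  have hnorm : coresLe ρk.toTopRep
        (inf_le_right : rootsOfUnityFixer ℚ ((primesEquiv q : Nat.Primes) : ℕ) ⊓ κ.layerSubgroup n ≤
          κ.layerSubgroup n) hUo
        (reduceH1Pk W p k _ (coresLe (tateRep W p).toTopRep hVU
          ((cyclotomicLevelsRat p S).isOpen_level (n + 1) _)
          (z (n + 1) ((cyclotomicLevelsRat p S).idealOne.cons q hq)))) =
      aeval (conjMap ρk.toTopRep (κ.layerSubgroup n) Fr⁻¹ 1).hom.toLinearMap
        Pz (reduceH1Pk W p k (κ.layerSubgroup n) (I.proj n s)) := by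
    rw [hproj n]
    exact coresLe_reduceH1Pk_coresLe_cons_eq_aeval W p k hz (n + 1) hq hq2 hFr Pz hPz hUo (h n)
      (inf_le_right : rootsOfUnityFixer ℚ ((primesEquiv q : Nat.Primes) : ℕ) ⊓ κ.layerSubgroup n ≤ _)
      hVU
  have ha' : (a : ZMod (p ^ n)) = -κ.layerIndex n Fr⁻¹ := by rw [κ.layerIndex_inv, neg_neg, ha]
  -- the class `y` (relative inverse Shapiro of the reduced layer class)
  refine ⟨coresLe (κ.twistModPk ρk (W.pow_nsmul_geomTorsion_eq_zero p k) J).toTopRep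
      (inf_le_left : rootsOfUnityFixer ℚ ((primesEquiv q : Nat.Primes) : ℕ) ⊓ κ.layerSubgroup n ≤
        rootsOfUnityFixer ℚ ((primesEquiv q : Nat.Primes) : ℕ)) hUo
      (cohomologyMap (restrictHomOfLe
        (inf_le_right : rootsOfUnityFixer ℚ ((primesEquiv q : Nat.Primes) : ℕ) ⊓ κ.layerSubgroup n ≤
          κ.layerSubgroup n)
        (κ.unitCoeffPkHom ρk (W.pow_nsmul_geomTorsion_eq_zero p k) J n hJ)) 1
        (reduceH1Pk W p k _ (coresLe (tateRep W p).toTopRep hVU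
          ((cyclotomicLevelsRat p S).isOpen_level (n + 1) _)
          (z (n + 1) ((cyclotomicLevelsRat p S).idealOne.cons q hq))))), ?_, ?_⟩
  · -- (i) integrality
    refine TameClass.coresLe_mem_integralH1_inf _ p hUo (fun v hv 𝔓 h𝔓 ↦ ?_)
      (TameClass.cohomologyMap_mem_integralH1 ρk _ p _ hred)
    exact CoresUnramified.subgroupIsUnramifiedAt_layerSubgroup κ
      (WeierstrassCurve.natCast_not_mem_asIdeal_of_primesEquiv_ne Fact.out hv) n 𝔓 h𝔓
  · -- (ii) the norm relation, in cocycle form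
    intro φ hφ
    have hφ' : oneCocycleClass _ φ = κ.coresShapiroPk ρk (W.pow_nsmul_geomTorsion_eq_zero p k) J n hJ
        (reduceH1Pk W p k (κ.layerSubgroup n) (I.proj n s)) := by
      rw [hφ]
      exact I.redTowerPk_apply_coe_eq_of_level k s J hJ
    obtain ⟨ψ, hψ, hclass⟩ := exists_cocycle_coresShapiroPk_aeval_conjMap κ ρk
      (W.pow_nsmul_geomTorsion_eq_zero p k) J n hJ Fr⁻¹ ha' Pz
      (reduceH1Pk W p k (κ.layerSubgroup n) (I.proj n s)) φ hφ'
    refine ⟨ψ, hψ, ?_⟩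
    rw [cores_coresLe_cohomologyMap_unitCoeffPk κ ρk (W.pow_nsmul_geomTorsion_eq_zero p k) J n _ hJ hN hUo,
      hnorm]
    exact hclass

end Summit.BirchSwinnertonDyer.BirchSwinnertonDyer.Theorems.OneSidedTwistSqueezeX9KatoDivisibilityX9KolyvaginReciprocityPkTameClass

end
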